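/-
Copyright (c) 2026 the pub-hodgecm-mathlib formalisation cell (harness21).  Prover seat hodgecm-mathlib-LH4-p06 (g5), Track A «(D-RAM) FOUR-FRAME», unit U2H, census leaf
(ρ2b′-X) `stub_U2H_fixedPointCensus_typeTwo_unit0` — SOCKET (C) `orderCountCensusC` (type RamM), hand (C-1P) «the u-FREE `+` TABLE `hnP` of ★ p857711» (LH4-p04 (g5) SOCKET (C)
LEAD LINES #1–#2): `#levelSet_h(j,a)` for EVERY cell, translator class at even K♮-levels.  2026-09-04.
-/
import Summits.HodgeConjecture.HodgeConjecture.Theorems.F0P3cDyRamToricLevelCensusRamMTablesPrep   -- (C-1 prep, this seat): row engines; brings ★ T5c base p857497∕535∕549 (`…_explicit_…`), ★ p857782, ★ p857465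
import HarnessLib

/-!
# T5c (C-1P): the u-free `+` table of the RamM census — `#levelSet_h(j,a) = ‹★ p857711's hnP›` for every `(j, a)`

Cell `hodgecm-mathlib` (D-0151), FLOOR 0, crux H413 = `stmt-HodgeConjecture-24833`; squad F0∕P3c∕LH4; lane `--supports stmt-HodgeConjecture-24833 --as helper` (count-neutral).
THEOREMS ONLY (no `def`, no instance, no notation, no `sorry`, default heartbeats).  Socket served: LH4-p04 (g5)'s SOCKET (C), letter `hnP` of ★ `toricCensusSum_ramM` for
`nP j a := #levelSet_h(j,a)` — the `ℕ`-expression of ★ p857711 :63–:67 VERBATIM (K♮-level `k = j − a − s0`):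
`j = 0 ↦ [a = 0]`; `j < a ↦ 0`; `k = −1 ↦ q^j`; `k < −1 ↦ [a = 0]·q^j`; `k` odd `↦ 0`; `k` even, `a = 0 ↦ (2g ≤ k ? 2 : 1)·q^{j−k∕2}`;
`k` even, `a ≥ 1 ↦ (q−1)q^{j−1−k∕2} ∣ (q−2)q^{j−1−k∕2} ∣ 2(q−1)q^{j−1−k∕2}` on `k + 2 <,=,> 2g`.
ROWS: shallow ∕ `k = −1` ∕ dead rows = (C-1 prep) engines under the CLASS LETTERS of the scalar `h` (`Θh = h`; `η(k₀) = (ρh∕h)·t(α^{k₀})`, level index `k₀ = a − j − e`,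
`v_h + d_ρ = 2e`): `hcls0` (every class within K♮-depth `d′ − 1` of `−1`), `hclsT` (even parity `k₀ + s0 + e`: a unit TRANSLATOR — the hyperbolic line), `hclsO` (odd parity: NOT met
at K♮-depth `d′` — the odd class); even rows `k ≥ 0` = ★ T5c `ncard_levelSet_(zero_)eq_explicit_even_of_ramified` + ★ p857465's indices, in `ℕ` (`2 ∣ q`).
HONEST LABEL.  Count-neutral (`--supports`); unconditional local algebra; nothing of (ρ2b′-X) is asserted — `HC_CM` is proved only modulo the 7 printed citations (2 remaining named
inputs: hLiu418 = `stmt-HodgeConjecture-24832`, h413 = `stmt-HodgeConjecture-24833`) until rung 0 closes.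

## References
* [Flicker1998UnitaryFL] Y. Z. Flicker, *Elementary proof of the fundamental lemma for a unitary group*, Canad. J. Math. 50 (1998): Prop. 7 p. 84 (the level tables).
* [Serre1979] J.-P. Serre, *Local Fields*, GTM 67 (1979): Ch. V §3 Cor. 3.
* [Jacobowitz1962] R. Jacobowitz, *Hermitian forms over local fields*, Amer. J. Math. 84 (1962): §4.
-/

set_option autoImplicit false

noncomputable section

namespace Summit.HodgeConjecture.HodgeConjecture.Cruxes.H413.F0P3cDyRamToricLevelCensusRamM

open WithZero IsLocalRing
open scoped Valued
open Literature.NumberTheory.Automorphic.UnitaryThreeFourFrame (IsRamifiedQuadraticDatum)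
open Literature.NumberTheory.LocalFields.QuadraticOrder Literature.NumberTheory.LocalFields.WildQuadraticDatum
open Summit.HodgeConjecture.HodgeConjecture.Cruxes.H413.F0P3cDyRamToricCensusDefs

variable {K : Type} [Field K] [Valued K ℤᵐ⁰] {ρ Θ : K →+* K} {α ϖE h : K} {dρ t : ℕ}
variable {K' : Type*} [Field K'] [Valued K' ℤᵐ⁰] {σ' : K' →+* K'} {π' : K'} {d' : ℕ}

/-! ## §1 `ℕ` arithmetic of the even rows -/

/-- `q^j ∕ (q^n ∕ 2) = 2·q^{j−n}` in `ℕ` (`2 ∣ q`, `1 ≤ n ≤ j`). [cite: Flicker1998UnitaryFL, Prop. 7 p. 84] -/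
theorem pow_div_half_pow {q j n : ℕ} (hq : 0 < q) (hq2 : 2 ∣ q) (hn1 : 1 ≤ n) (hn : n ≤ j) : q ^ j / (q ^ n / 2) = 2 * q ^ (j - n) := by
  obtain ⟨e, he⟩ : 2 ∣ q ^ n := hq2.trans (dvd_pow_self q (by omega))
  have he0 : 0 < e := by have hp : 0 < q ^ n := pow_pos hq n; rw [he] at hp; omega
  have hj : q ^ j = 2 * q ^ (j - n) * e := by rw [← pow_sub_mul_pow q hn, he]; ring
  rw [he, Nat.mul_div_cancel_left e (by norm_num), hj, Nat.mul_div_cancel _ he0]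

/-- `q^{n+1} − q^n = (q − 1)·q^n` in `ℕ`. [cite: Flicker1998UnitaryFL, Prop. 7 p. 84] -/
theorem pow_succ_sub_pow (q n : ℕ) : q ^ (n + 1) - q ^ n = (q - 1) * q ^ n := by
  rw [pow_succ, Nat.sub_mul, one_mul, mul_comm]

/-- `q^{n+1} − 2·q^n = (q − 2)·q^n` in `ℕ`. [cite: Flicker1998UnitaryFL, Prop. 7 p. 84] -/
theorem pow_succ_sub_two_mul_pow (q n : ℕ) : q ^ (n + 1) - 2 * q ^ n = (q - 2) * q ^ n := by
  rw [pow_succ, Nat.sub_mul, mul_comm]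

/-- `2·q^{n+1} − 2·q^n = 2(q − 1)·q^n` in `ℕ`. [cite: Flicker1998UnitaryFL, Prop. 7 p. 84] -/
theorem two_mul_pow_succ_sub (q n : ℕ) : 2 * q ^ (n + 1) - 2 * q ^ n = 2 * (q - 1) * q ^ n := by
  rw [mul_assoc, ← Nat.mul_sub, pow_succ_sub_pow]

/-! ## §2 The `+` table -/

/-- **THE u-FREE `+` TABLE `hnP` OF ★ `toricCensusSum_ramM`.**  Frame: ρ-datum, `Θ`-datum (so `Θ` is an isometric involution commuting with `ρ`), third-field package
(`K′` a DVR image with `#𝓀 = q = #𝓀_M`, `M` complete), `hFN`, `|ϖE| = exp(−2)`, `ρϖE = ϖE`, `2 ∣ q`; the scalar `h ≠ 0`, `Θh = h`, `|h| = exp(−v_h)` with `v_h + d_ρ = 2e`;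
dictionary `dΘ = 2g`, `2d′ = d_ρ + 2s0`, `1 ≤ s0`; CLASS LETTERS of `h` indexed by the level index `k₀` (`η(k₀) = (ρh∕h)·t(α^{k₀})`): `hcls0`, `hclsT` (even `k₀ + s0 + e`:
translator), `hclsO` (odd: not met at K♮-depth `d′`).  Then for all `j a`: `#levelSet_h(j,a) =` ★ p857711's `hnP` expression.
[cite: Flicker1998UnitaryFL, Prop. 7 p. 84] [cite: Serre1979, Ch. V §3 Cor. 3] [cite: Jacobowitz1962, §4] -/
theorem ncard_levelSet_eq_hnP [CompleteSpace K] [IsDiscreteValuationRing 𝒪[K]] [Finite 𝓀[K]] [IsDiscreteValuationRing 𝒪[K']] [Finite 𝓀[K']]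
    (hD : IsRamifiedQuadraticDatum ρ α dρ t) (hΘρ : ∀ x, Θ (ρ x) = ρ (Θ x)) (hvΘ : ∀ x, Valued.v (Θ x) = Valued.v x)
    (hϖE : Valued.v ϖE = exp (-2 : ℤ)) (hρϖ : ρ ϖE = ϖE) {q : ℕ} (hq : Nat.card 𝓀[K] = q) (hq' : Nat.card 𝓀[K'] = q) (hq2 : 2 ∣ q)
    (hσ' : ∀ x, σ' (σ' x) = x) (hvσ' : ∀ x, Valued.v (σ' x) = Valued.v x) (hfix' : ∀ x : K', σ' x = x → x ≠ 0 → ∃ n : ℤ, Valued.v x = exp (2 * n))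
    (hπ' : Valued.v π' = exp (-1 : ℤ)) (hdd' : Valued.v (π' - σ' π') = Valued.v π' ^ d')
    (jK : K' →+* K) (hjle : ∀ x y : K', Valued.v (jK x) ≤ Valued.v (jK y) ↔ Valued.v x ≤ Valued.v y) (hjΘ : ∀ x, Θ (jK x) = jK x)
    (hjfix : ∀ z : K, Θ z = z → ∃ x, jK x = z) (hjσ : ∀ x, jK (σ' x) = ρ (jK x)) (hjπ : Valued.v (jK π') = exp (-2 : ℤ))
    {ϖ : K} {dΘ tΘ : ℕ} (hDΘ : IsRamifiedQuadraticDatum Θ ϖ dΘ tΘ)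
    (hFN : ∀ f : K, ρ f = f → Θ f = f → Valued.v f = 1 → ∃ x : K, x * Θ x = f)
    (hΘh : Θ h = h) (hh : h ≠ 0) {vh : ℤ} (hvh : Valued.v h = exp (-vh)) {e : ℤ} (he : vh + dρ = 2 * e)
    {g s0 : ℕ} (hg : dΘ = 2 * g) (hds : 2 * d' = dρ + 2 * s0) (hs1 : 1 ≤ s0)
    (hcls0 : ∀ k₀ : ℤ, Valued.v (1 + ρ h / h * (ρ (α ^ k₀ * Θ (α ^ k₀)) / (α ^ k₀ * Θ (α ^ k₀)))) ≤ exp (-(2 * (d' : ℤ) - 2)))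
    (hclsT : ∀ k₀ : ℤ, (∃ r : ℤ, k₀ + s0 + e = 2 * r) → ∃ ω₀ : Kˣ, Valued.v (ω₀ : K) = 1 ∧
      ρ h / h * (ρ (α ^ k₀ * Θ (α ^ k₀)) / (α ^ k₀ * Θ (α ^ k₀))) * (ρ ((ω₀ : K) * Θ ω₀) / ((ω₀ : K) * Θ ω₀)) = -1)
    (hclsO : ∀ k₀ : ℤ, (∃ r : ℤ, k₀ + s0 + e = 2 * r + 1) → ∀ ω : Kˣ, Valued.v (ω : K) = 1 →
      ¬ Valued.v (1 + ρ h / h * (ρ (α ^ k₀ * Θ (α ^ k₀)) / (α ^ k₀ * Θ (α ^ k₀))) * (ρ ((ω : K) * Θ ω) / ((ω : K) * Θ ω))) ≤ exp (-(2 * (d' : ℤ))))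
    (j a : ℕ) :
    (levelSet ρ Θ α ϖE h j a).ncard =
      (if j = 0 then (if a = 0 then 1 else 0) else if j < a then 0
        else if j - a + 1 = s0 then q ^ j else if j - a + 1 < s0 then (if a = 0 then q ^ j else 0) else if (j - a - s0) % 2 = 1 then 0
        else if a = 0 then (if 2 * g ≤ j - a - s0 then 2 else 1) * q ^ (j - (j - a - s0) / 2)
        else if j - a - s0 + 2 < 2 * g then (q - 1) * q ^ (j - 1 - (j - a - s0) / 2) else if j - a - s0 + 2 = 2 * g then (q - 2) * q ^ (j - 1 - (j - a - s0) / 2)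
        else 2 * (q - 1) * q ^ (j - 1 - (j - a - s0) / 2) : ℕ) := by
  have hΘΘ := hDΘ.1
  have hvρ := hD.2.1
  have hdρ := v_sub_map_eq_exp_of_datum hD
  have hg1 : 1 ≤ g := by have h1 := hDΘ.2.2.2.2.2.1; omega
  have hq0 : 0 < q := Nat.pos_of_ne_zero (card_residueField_ne_zero hq)
  -- the cell's level index
  have hk₀ : vh + dρ + 2 * ((a : ℤ) - j - e) + 2 * j = 2 * a := by omega
  -- the shallow rows
  have row0 : 2 * (j : ℤ) + dρ + 2 ≤ 2 * d' → (levelSet ρ Θ α ϖE h j 0).ncard = q ^ j := fun hsh =>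
    ncard_levelSet_zero_eq_pow_of_shallow hD hΘΘ hvΘ hϖE hρϖ hq hσ' hfix' hπ' hdd' jK hjle hjfix hjσ hjπ hh hvh j (k₀ := (0 : ℤ) - j - e) (by omega)
      (hcls0 _) hsh
  have row1 : 1 ≤ a → 2 * (j : ℤ) + dρ + 3 ≤ 2 * a + 2 * d' → (levelSet ρ Θ α ϖE h j a).ncard = 0 := fun ha hsh =>
    ncard_levelSet_pos_eq_zero_of_shallow hD hΘΘ hΘρ hvΘ hϖE hρϖ hq hσ' hfix' hπ' hdd' jK hjle hjfix hjσ hjπ hh hvh j ha hk₀ (hcls0 _) hsh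
  by_cases hj0 : j = 0
  · subst hj0
    rw [if_pos rfl]
    by_cases ha0 : a = 0
    · subst ha0; rw [if_pos rfl, row0 (by omega), pow_zero]
    · rw [if_neg ha0]; exact row1 (by omega) (by push_cast; omega)
  rw [if_neg hj0]
  by_cases hja : j < a
  · rw [if_pos hja]; exact row1 (by omega) (by omega)
  rw [if_neg hja]
  by_cases hk1 : j - a + 1 = s0
  · ---------------------------------------------------------------- `k = −1`
    rw [if_pos hk1]
    rcases Nat.eq_zero_or_pos a with rfl | ha
    · exact row0 (by omega)
    · exact ncard_levelSet_pos_eq_pow_of_notMet hD hΘρ hvΘ hϖE hρϖ hq hσ' hfix' hπ' hdd' jK hjle hjfix hjσ hjπ hDΘ hΘh hh hvh j ha hk₀ (hcls0 _)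
        (hclsO _ ⟨(a : ℤ) - j - e + s0 + e - 1 - ((a : ℤ) - j - e + s0 + e - 1) / 2 * 2 + ((a : ℤ) - j - e + s0 + e - 1) / 2, by omega⟩) (by omega)
  rw [if_neg hk1]
  by_cases hk2 : j - a + 1 < s0
  · ---------------------------------------------------------------- `k ≤ −2`
    rw [if_pos hk2]
    rcases Nat.eq_zero_or_pos a with rfl | ha
    · rw [if_pos rfl]; exact row0 (by omega)
    · rw [if_neg (by omega)]; exact row1 ha (by omega)
  rw [if_neg hk2]
  -- from here on `k = j − a − s0 ≥ 0`
  by_cases hodd : (j - a - s0) % 2 = 1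
  · ---------------------------------------------------------------- `k` odd: the odd class is dead
    rw [if_pos hodd]
    have hpar : ∃ r : ℤ, (a : ℤ) - j - e + s0 + e = 2 * r + 1 := ⟨-(((j - a - s0) / 2 : ℕ) : ℤ) - 1, by omega⟩
    rcases Nat.eq_zero_or_pos a with rfl | ha
    · exact ncard_levelSet_zero_eq_zero_of_notMet hD hvΘ hϖE hρϖ hh hvh j (k₀ := (0 : ℤ) - j - e) (by omega) fun ω hω hle =>
        hclsO _ (by simpa using hpar) ω hω (hle.trans (by rw [exp_le_exp]; omega))
    · exact ncard_levelSet_pos_eq_zero_of_notMet hD hvΘ hϖE hρϖ hh hvh j ha hk₀ fun ω hω hle =>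
        hclsO _ hpar ω hω (hle.trans (by rw [exp_le_exp]; omega))
  rw [if_neg hodd]
  -- `k = 2n` even: the translator class, ★ T5c explicit
  obtain ⟨n, hn⟩ : ∃ n : ℕ, j - a - s0 = 2 * n := ⟨(j - a - s0) / 2, by omega⟩
  have hnk : (j - a - s0) / 2 = n := by omega
  obtain ⟨ω₀, hω₀, hη⟩ := hclsT ((a : ℤ) - j - e) ⟨-(n : ℤ), by omega⟩
  obtain ⟨U, hU⟩ := Literature.NumberTheory.LocalFields.WildQuadraticDatum.exists_subgroup_v_eq_one (K := K)
  obtain ⟨H, hH⟩ := exists_subgroup_orderUnits (ρ := ρ) (α := α) hvρ (ϖE ^ j)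
  rcases Nat.eq_zero_or_pos a with rfl | ha
  · ---------------------------------------------------------------- `a = 0`
    rw [if_pos rfl, hnk]
    obtain ⟨B, hB⟩ := exists_subgroup_normDepth (Θ := Θ) hvρ hvΘ (exp (-(2 * (j : ℤ) + dρ)))
    have hHB : H ≤ B := orderUnits_le_normDepth hvρ hΘρ hvΘ (by rw [v_conductorR (ρ := ρ) hdρ hϖE j]) hH hB
    have hBU : B ≤ U := fun ω hω => (hU ω).2 ((hB ω).1 hω).1
    rw [ncard_levelSet_zero_eq_explicit_even_of_ramified hD hvΘ hϖE hρϖ hq hq' hσ' hvσ' hfix' hπ' hdd' jK hjle hjΘ hjfix hjσ hjπ hDΘ hFN hh hvh j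
      (k₀ := (0 : ℤ) - j - e) (by omega) (m := n) (by omega) hω₀ hη U H B hU hH hB hHB hBU]
    by_cases hgn : dΘ ≤ 2 * n + 1
    · rw [if_pos hgn, if_pos (show 2 * g ≤ j - 0 - s0 by omega), pow_div_half_pow hq0 hq2 (by omega) (by omega)]
    · rw [if_neg hgn, if_neg (show ¬ (2 * g ≤ j - 0 - s0) by omega), Nat.pow_div (by omega) hq0, one_mul]
  · ---------------------------------------------------------------- `a ≥ 1`
    rw [if_neg (by omega), hnk]
    obtain ⟨B, hB⟩ := exists_subgroup_normDepth (Θ := Θ) hvρ hvΘ (exp (2 * (a : ℤ) - 2 * j - dρ))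
    obtain ⟨B', hB'⟩ := exists_subgroup_normDepth (Θ := Θ) hvρ hvΘ (exp (2 * (a : ℤ) - 2 * j - dρ - 1))
    have hHB' : H ≤ B' := orderUnits_le_normDepth hvρ hΘρ hvΘ (by rw [v_conductorR (ρ := ρ) hdρ hϖE j, exp_le_exp]; omega) hH hB'
    have hB'B : B' ≤ B := fun ω hω => (hB ω).2 ⟨((hB' ω).1 hω).1, ((hB' ω).1 hω).2.trans (by rw [exp_le_exp]; omega)⟩
    have hBU : B ≤ U := fun ω hω => (hU ω).2 ((hB ω).1 hω).1
    rw [ncard_levelSet_eq_explicit_even_of_ramified hD hvΘ hϖE hρϖ hq hq' hσ' hvσ' hfix' hπ' hdd' jK hjle hjΘ hjfix hjσ hjπ hDΘ hΘρ hFN hh hvh j ha hk₀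
      (m := n) (by omega) hω₀ hη U H B B' hU hH hB hB' hHB' hB'B hBU]
    have hjn : j - n = (j - 1 - n) + 1 := by omega
    have hjn' : j - (n + 1) = j - 1 - n := by omega
    by_cases hlt : 2 * n + 2 < 2 * g
    · rw [show (if dΘ ≤ 2 * n + 1 then q ^ n / 2 else q ^ n) = q ^ n from if_neg (by omega),
        show (if dΘ ≤ 2 * n + 2 then q ^ (n + 1) / 2 else q ^ (n + 1)) = q ^ (n + 1) from if_neg (by omega),
        if_pos (show j - a - s0 + 2 < 2 * g by omega), Nat.pow_div (by omega) hq0, Nat.pow_div (by omega) hq0, hjn', hjn, pow_succ_sub_pow]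
    by_cases heq : 2 * n + 2 = 2 * g
    · rw [show (if dΘ ≤ 2 * n + 1 then q ^ n / 2 else q ^ n) = q ^ n from if_neg (by omega),
        show (if dΘ ≤ 2 * n + 2 then q ^ (n + 1) / 2 else q ^ (n + 1)) = q ^ (n + 1) / 2 from if_pos (by omega),
        if_neg (show ¬ (j - a - s0 + 2 < 2 * g) by omega), if_pos (show j - a - s0 + 2 = 2 * g by omega),
        Nat.pow_div (by omega) hq0, pow_div_half_pow hq0 hq2 (by omega) (by omega), hjn', hjn, pow_succ_sub_two_mul_pow]
    · rw [show (if dΘ ≤ 2 * n + 1 then q ^ n / 2 else q ^ n) = q ^ n / 2 from if_pos (by omega),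
        show (if dΘ ≤ 2 * n + 2 then q ^ (n + 1) / 2 else q ^ (n + 1)) = q ^ (n + 1) / 2 from if_pos (by omega),
        if_neg (show ¬ (j - a - s0 + 2 < 2 * g) by omega), if_neg (show ¬ (j - a - s0 + 2 = 2 * g) by omega),
        pow_div_half_pow hq0 hq2 (by omega) (by omega), pow_div_half_pow hq0 hq2 (by omega) (by omega), hjn', hjn, two_mul_pow_succ_sub]

end Summit.HodgeConjecture.HodgeConjecture.Cruxes.H413.F0P3cDyRamToricLevelCensusRamM

end
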